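import Mathlib
import Literature.RepresentationTheory.FiniteGroups.KLRGradedCellularBasis
import Summits.MatrixMultiplication.MatrixMultiplication.Theorems.SnSubsetDichotomyNoThresholdSubsetTripleTwoMulTableauDegreeStep
import Summits.MatrixMultiplication.MatrixMultiplication.Theorems.SnSubsetDichotomyNoThresholdSubsetTripleAltCornerCharge

/-!
# `SnSubsetDichotomy.NoThresholdSubsetTriple`, line `klr-graded-polynomial-method`:
# stub `stub_transposeDegree` (transpose symmetry of the Brundan–Kleshchev–Wang `2`-degree)

For a standard Young tableau `T` of shape `μ ⊢ n` (growth sequence `T.1`) and its transpose `Tᵗ`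
(growth sequence `Prod.swap ∘ T.1`): `deg₂ T + deg₂ Tᵗ = c₀ − (c₀ − c₁)²`,
`cᵢ = residueContent 2 μ i`. Proof, per entry `k` with prefix `P = prefixCells T.1 k` (a lower
set) and new cell `A = T.1 k` (a removable node of `P`) of residue `i`:
* TRANSPOSITION: addable / removable nodes commute with `swap` and `2`-residues are
  `swap`-invariant, so the step of `Tᵗ` is the step of `T` with "strictly below `A`" replaced
  by "strictly right of `A`" (`tableauDegreeStep_swap`);
* CORNER DICHOTOMY: every addable node of `P`, and every removable node `≠ A`, lies strictly
  below or strictly right of `A`, never both; hence `step_k(T) + step_k(Tᵗ) = a_i(P) − r_i(P) + 1`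
  (`a_i, r_i` = numbers of addable / removable `i`-nodes; `step_add_step_swap`);
* `sl₂`-WEIGHT: `a₀ − r₀ = 1 − 2ξ`, `a₁ − r₁ = 2ξ`, `ξ = c₀(P) − c₁(P)` (`sl2_weight`), from the
  tree's `altCornerCharge_eq` at a large cut-off (`Σ_add π − Σ_rem π = 1 − 4ξ`,
  `π = (-1)^{row+col}`) and `#addable = #removable + 1` (the tree's `card_addable_below` for `P`
  and for its transpose, plus the dichotomy);
* TELESCOPING: `a_i(P) − r_i(P) + 1 = W(P) − W(P ∖ A)` for `W = c₀ − (c₀ − c₁)²`; sum over `k`.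
-/

namespace Summit.MatrixMultiplication.MatrixMultiplication.Theorems

open Literature.RepresentationTheory.FiniteGroups
open Literature.NumberTheory.DiophantineGeometry (StdFilling)
open TwoMulTableauDegreeStep

/-- Membership in the transposed set of cells. [folklore] -/
private theorem mem_image_swap {P : Finset (ℕ × ℕ)} {x : ℕ × ℕ} :
    x ∈ P.image Prod.swap ↔ x.swap ∈ P := by
  constructor
  · intro h
    obtain ⟨y, hy, rfl⟩ := Finset.mem_image.1 h
    rwa [Prod.swap_swap]
  · intro h
    exact Finset.mem_image.2 ⟨x.swap, h, x.swap_swap⟩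

/-- Addable nodes commute with transposition. [folklore] -/
private theorem isAddableNode_image_swap {P : Finset (ℕ × ℕ)} {x : ℕ × ℕ} :
    IsAddableNode (P.image Prod.swap) x ↔ IsAddableNode P x.swap := by
  obtain ⟨a, b⟩ := x
  simp only [IsAddableNode, mem_image_swap, Prod.swap_prod_mk]
  exact ⟨fun ⟨h1, h2, h3⟩ => ⟨h1, h3, h2⟩, fun ⟨h1, h2, h3⟩ => ⟨h1, h3, h2⟩⟩

/-- Removable nodes commute with transposition. [folklore] -/
private theorem isRemovableNode_image_swap {P : Finset (ℕ × ℕ)} {x : ℕ × ℕ} :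
    IsRemovableNode (P.image Prod.swap) x ↔ IsRemovableNode P x.swap := by
  obtain ⟨a, b⟩ := x
  simp only [IsRemovableNode, mem_image_swap, Prod.swap_prod_mk]
  exact ⟨fun ⟨h1, h2, h3⟩ => ⟨h1, h3, h2⟩, fun ⟨h1, h2, h3⟩ => ⟨h1, h3, h2⟩⟩

/-- The addable nodes of the transpose are the transposed addable nodes. [folklore] -/
private theorem addableNodes_image_swap (P : Finset (ℕ × ℕ)) :
    addableNodes (P.image Prod.swap) = (addableNodes P).image Prod.swap := by
  ext x
  rw [mem_addableNodes, isAddableNode_image_swap, mem_image_swap, mem_addableNodes]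

/-- The removable nodes of the transpose are the transposed removable nodes. [folklore] -/
private theorem removableNodes_image_swap (P : Finset (ℕ × ℕ)) :
    removableNodes (P.image Prod.swap) = (removableNodes P).image Prod.swap := by
  ext x
  rw [mem_removableNodes, isRemovableNode_image_swap, mem_image_swap, mem_removableNodes]

/-- For `p = 2` transposition preserves residues (`row − col = col − row` in `ZMod 2`).
[folklore] -/
private theorem cellResidue_two_swap (x : ℕ × ℕ) : cellResidue 2 x.swap = cellResidue 2 x := by
  unfold cellResidue
  rw [Prod.fst_swap, Prod.snd_swap, ← neg_sub, ZMod.neg_eq_self_mod_two]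

/-- **The degree step of the transposed tableau**, pulled back to the prefix `P = prefixCells f k`:
the addable minus the removable nodes of `P` of the residue of `A = f k` strictly RIGHT of `A`.
[folklore] -/
private theorem tableauDegreeStep_swap {n : ℕ} (f : Fin n → ℕ × ℕ) (k : Fin n) :
    tableauDegreeStep 2 (Prod.swap ∘ f) k =
      (((addableNodes (prefixCells f k)).filter fun B =>
          cellResidue 2 B = cellResidue 2 (f k) ∧ (f k).2 < B.2).card : ℤ) -
        (((removableNodes (prefixCells f k)).filter fun B =>
          cellResidue 2 B = cellResidue 2 (f k) ∧ (f k).2 < B.2).card : ℤ) := by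
  have hP : prefixCells (Prod.swap ∘ f) k = (prefixCells f k).image Prod.swap := by
    unfold prefixCells
    rw [Finset.image_image]
  unfold tableauDegreeStep
  rw [hP, addableNodes_image_swap, removableNodes_image_swap, Finset.filter_image,
    Finset.filter_image, Finset.card_image_of_injective _ Prod.swap_injective,
    Finset.card_image_of_injective _ Prod.swap_injective]
  simp only [Function.comp_apply, cellResidue_two_swap, Prod.fst_swap]

/-- Corner dichotomy, addable case: in a lower set `P` with a removable node `A`, an addable node
`B` lies strictly below `A` iff it does not lie strictly right of `A`. [folklore] -/
private theorem lt_fst_iff_of_isAddableNode {P : Finset (ℕ × ℕ)}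
    (hP : IsLowerSet (P : Set (ℕ × ℕ))) {A B : ℕ × ℕ} (hA : IsRemovableNode P A)
    (hB : IsAddableNode P B) : A.1 < B.1 ↔ ¬A.2 < B.2 := by
  obtain ⟨a₁, a₂⟩ := A
  obtain ⟨b₁, b₂⟩ := B
  obtain ⟨hAmem, -, hAright⟩ := hA
  obtain ⟨hBnot, hBup, -⟩ := hB
  dsimp only at hAright hBup ⊢
  constructor
  · intro h1 h2
    have hup : (b₁ - 1, b₂) ∈ P := hBup.resolve_left (by omega)
    exact hAright (hP (Prod.mk_le_mk.2 ⟨by omega, by omega⟩) hup)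
  · intro h2
    by_contra h1
    exact hBnot (hP (Prod.mk_le_mk.2 ⟨not_lt.1 h1, not_lt.1 h2⟩) hAmem)

/-- Corner dichotomy, removable case: in a lower set `P` with a removable node `A`, a removable
node `B ≠ A` lies strictly below `A` iff it does not lie strictly right of `A`. [folklore] -/
private theorem lt_fst_iff_of_isRemovableNode {P : Finset (ℕ × ℕ)}
    (hP : IsLowerSet (P : Set (ℕ × ℕ))) {A B : ℕ × ℕ} (hA : IsRemovableNode P A)
    (hB : IsRemovableNode P B) (hne : B ≠ A) : A.1 < B.1 ↔ ¬A.2 < B.2 := by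
  obtain ⟨a₁, a₂⟩ := A
  obtain ⟨b₁, b₂⟩ := B
  obtain ⟨hAmem, hAdown, hAright⟩ := hA
  obtain ⟨hBmem, hBdown, hBright⟩ := hB
  dsimp only at hAdown hAright hBdown hBright ⊢
  constructor
  · intro h1 h2
    exact hAdown (hP (Prod.mk_le_mk.2 ⟨Nat.succ_le_of_lt h1, h2.le⟩) hBmem)
  · intro h2
    by_contra h1
    rw [not_lt] at h1 h2
    rcases h1.lt_or_eq with h1 | rfl
    · exact hBdown (hP (Prod.mk_le_mk.2 ⟨Nat.succ_le_of_lt h1, h2⟩) hAmem)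
    · rcases h2.lt_or_eq with h2 | rfl
      · exact hBright (hP (Prod.mk_le_mk.2 ⟨le_rfl, Nat.succ_le_of_lt h2⟩) hAmem)
      · exact hne rfl

/-- A set `S` of addable nodes of a lower set splits at a removable node `A` into the nodes
strictly below `A` and the nodes strictly right of `A`. [folklore] -/
private theorem card_filter_add_of_subset_addableNodes {P : Finset (ℕ × ℕ)}
    (hP : IsLowerSet (P : Set (ℕ × ℕ))) {A : ℕ × ℕ} (hA : IsRemovableNode P A)
    {S : Finset (ℕ × ℕ)} (hS : S ⊆ addableNodes P) :
    (S.filter fun B => A.1 < B.1).card + (S.filter fun B => A.2 < B.2).card = S.card := by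
  have h : (S.filter fun B => A.2 < B.2) = S.filter fun B => ¬A.1 < B.1 :=
    Finset.filter_congr fun B hB => by
      rw [lt_fst_iff_of_isAddableNode hP hA (mem_addableNodes.1 (hS hB)), not_not]
  rw [h, Finset.card_filter_add_card_filter_not]

/-- A set `S` of removable nodes of a lower set containing the removable node `A` splits into
`A`, the nodes strictly below `A` and the nodes strictly right of `A`. [folklore] -/
private theorem card_filter_add_of_subset_removableNodes {P : Finset (ℕ × ℕ)}
    (hP : IsLowerSet (P : Set (ℕ × ℕ))) {A : ℕ × ℕ} (hA : IsRemovableNode P A)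
    {S : Finset (ℕ × ℕ)} (hS : S ⊆ removableNodes P) (hAS : A ∈ S) :
    (S.filter fun B => A.1 < B.1).card + (S.filter fun B => A.2 < B.2).card + 1 = S.card := by
  have h : (S.filter fun B => A.2 < B.2) = (S.filter fun B => ¬A.1 < B.1).erase A := by
    ext B
    rw [Finset.mem_erase, Finset.mem_filter, Finset.mem_filter]
    constructor
    · rintro ⟨hB, h2⟩
      have hne : B ≠ A := by
        rintro rfl
        exact lt_irrefl _ h2
      exact ⟨hne, hB, fun h1 =>
        (lt_fst_iff_of_isRemovableNode hP hA (mem_removableNodes.1 (hS hB)) hne).1 h1 h2⟩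
    · rintro ⟨hne, hB, h1⟩
      refine ⟨hB, ?_⟩
      by_contra h2
      exact h1 ((lt_fst_iff_of_isRemovableNode hP hA (mem_removableNodes.1 (hS hB)) hne).2 h2)
  have hA' : A ∈ S.filter fun B => ¬A.1 < B.1 := Finset.mem_filter.2 ⟨hAS, lt_irrefl _⟩
  have hpos := Finset.card_pos.2 ⟨A, hA'⟩
  have hsum := Finset.card_filter_add_card_filter_not (s := S) (fun B => A.1 < B.1)
  rw [h, Finset.card_erase_of_mem hA']
  omega

/-- A lower set with a removable node `A` has one more addable node than removable nodes: the
corners other than `A` lie strictly below or strictly right of `A`, and on each side there is one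
more addable than removable corner (`card_addable_below` for `P` and its transpose). [folklore] -/
private theorem card_addableNodes_eq {P : Finset (ℕ × ℕ)} (hP : IsLowerSet (P : Set (ℕ × ℕ)))
    {A : ℕ × ℕ} (hA : IsRemovableNode P A) :
    (addableNodes P).card = (removableNodes P).card + 1 := by
  have hP' : IsLowerSet ((P.image Prod.swap : Finset (ℕ × ℕ)) : Set (ℕ × ℕ)) := by
    intro x y hyx hx
    rw [Finset.mem_coe, mem_image_swap] at hx ⊢
    exact hP (Prod.swap_le_swap.2 hyx) hx
  have hA' : IsRemovableNode (P.image Prod.swap) A.swap := by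
    rw [isRemovableNode_image_swap, Prod.swap_swap]
    exact hA
  have h1 : ((addableNodes P).filter fun B => A.1 < B.1).card =
      ((removableNodes P).filter fun B => A.1 < B.1).card + 1 :=
    card_addable_below ⟨P, hP⟩ hA
  have h2 : ((addableNodes (P.image Prod.swap)).filter fun B => A.swap.1 < B.1).card =
      ((removableNodes (P.image Prod.swap)).filter fun B => A.swap.1 < B.1).card + 1 :=
    card_addable_below ⟨P.image Prod.swap, hP'⟩ hA'
  rw [addableNodes_image_swap, removableNodes_image_swap, Finset.filter_image,
    Finset.filter_image, Finset.card_image_of_injective _ Prod.swap_injective,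
    Finset.card_image_of_injective _ Prod.swap_injective] at h2
  simp only [Prod.fst_swap] at h2
  have h3 := card_filter_add_of_subset_addableNodes hP hA (Finset.Subset.refl (addableNodes P))
  have h4 := card_filter_add_of_subset_removableNodes hP hA
    (Finset.Subset.refl (removableNodes P)) (mem_removableNodes.2 hA)
  omega

/-- The total alternating corner charge of a lower set:
`Σ_{addable} (-1)^{row+col} − Σ_{removable} (-1)^{row+col} = 1 − 4 Σ_{x ∈ P} (-1)^{row+col}`
(the tree's `altCornerCharge_eq` at a cut-off exceeding every content by `2`). [folklore] -/
private theorem altCharge_total {P : Finset (ℕ × ℕ)} (hP : IsLowerSet (P : Set (ℕ × ℕ))) :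
    (addableNodes P).sum (fun B => (-1 : ℤ) ^ (B.1 + B.2)) -
        (removableNodes P).sum (fun B => (-1 : ℤ) ^ (B.1 + B.2)) =
      1 - 4 * P.sum (fun x => (-1 : ℤ) ^ (x.1 + x.2)) := by
  have hP' : ∀ x ∈ P, ∀ y : ℕ × ℕ, y ≤ x → y ∈ P := fun x hx y hyx => hP hyx hx
  obtain ⟨M, hle⟩ : ∃ M : ℕ, ∀ x ∈ P, x.2 ≤ M :=
    ⟨P.sum fun x => x.2, fun x hx =>
      Finset.single_le_sum (f := fun x : ℕ × ℕ => x.2) (fun _ _ => Nat.zero_le _) hx⟩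
  have key := altCornerCharge_eq P hP' ((M : ℤ) + 2)
  have hA : ((addableNodes P).filter fun B => (B.2 : ℤ) - B.1 < (M : ℤ) + 2) = addableNodes P :=
    Finset.filter_true_of_mem fun B hB => by
      rcases (mem_addableNodes.1 hB).2.2 with h | h
      · omega
      · have := hle _ h
        dsimp only at this
        omega
  have hR : ((removableNodes P).filter fun B => (B.2 : ℤ) - B.1 < (M : ℤ) + 2) =
      removableNodes P :=
    Finset.filter_true_of_mem fun B hB => by
      have := hle _ (mem_removableNodes.1 hB).1
      omega
  rw [hA, hR, if_pos (by omega)] at key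
  rw [key, Finset.mul_sum]
  congr 1
  refine Finset.sum_congr rfl fun x hx => ?_
  have := hle x hx
  rw [if_pos (by omega)]

/-- In `ZMod 2` every element is `0` or `1`. [folklore] -/
private theorem zmod_two_cases : ∀ x : ZMod 2, x = 0 ∨ x = 1 := by
  decide

/-- In `ZMod 2`, being `1` means not being `0`. [folklore] -/
private theorem zmod_two_eq_one_iff : ∀ x : ZMod 2, x = 1 ↔ ¬x = 0 := by
  decide

/-- **The `sl₂`-weight of a Young diagram at `e = 2`.** For a lower set `P` with a removable
node, `aᵢ, rᵢ` the numbers of addable / removable nodes of `2`-residue `i`, `ξ = c₀ − c₁`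
(`cᵢ` = number of cells of residue `i`): `a₀ − r₀ = 1 − 2ξ` and `a₁ − r₁ = 2ξ` (from
`Σ_add π − Σ_rem π = 1 − 4ξ`, `π = ±1` according to the residue, and `#add = #rem + 1`).
[folklore] -/
private theorem sl2_weight {P : Finset (ℕ × ℕ)} (hP : IsLowerSet (P : Set (ℕ × ℕ))) {A : ℕ × ℕ}
    (hA : IsRemovableNode P A) :
    (((addableNodes P).filter fun B => cellResidue 2 B = 0).card : ℤ) -
          (((removableNodes P).filter fun B => cellResidue 2 B = 0).card : ℤ) =
        1 - 2 * (((P.filter fun x => cellResidue 2 x = 0).card : ℤ) -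
          ((P.filter fun x => ¬cellResidue 2 x = 0).card : ℤ)) ∧
      (((addableNodes P).filter fun B => ¬cellResidue 2 B = 0).card : ℤ) -
          (((removableNodes P).filter fun B => ¬cellResidue 2 B = 0).card : ℤ) =
        2 * (((P.filter fun x => cellResidue 2 x = 0).card : ℤ) -
          ((P.filter fun x => ¬cellResidue 2 x = 0).card : ℤ)) := by
  have h00 : cellResidue 2 ((0 : ℕ), (0 : ℕ)) = 0 := by decide
  have e1 := neg_one_pow_mul_sum ((0 : ℕ), (0 : ℕ)) (addableNodes P)
  have e2 := neg_one_pow_mul_sum ((0 : ℕ), (0 : ℕ)) (removableNodes P)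
  have e3 := neg_one_pow_mul_sum ((0 : ℕ), (0 : ℕ)) P
  simp only [h00, add_zero, pow_zero, one_mul] at e1 e2 e3
  have h1 := altCharge_total hP
  have h2 := card_addableNodes_eq hP hA
  have c1 := Finset.card_filter_add_card_filter_not (s := addableNodes P)
    (fun B => cellResidue 2 B = 0)
  have c2 := Finset.card_filter_add_card_filter_not (s := removableNodes P)
    (fun B => cellResidue 2 B = 0)
  constructor <;> omega

/-- **Per-step transpose symmetry.** For a standard tableau `T` and an entry `k` with cell
`A = T.1 k` in the prefix `P = prefixCells T.1 k`, `i = res₂ A`: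
`step_k(T) + step_k(Tᵗ) = a_i(P) − r_i(P) + 1` — the addable `i`-nodes split into "below `A`"
(counted by `T`) and "right of `A`" (counted by `Tᵗ`), the removable ones likewise apart from
`A` itself. [folklore] -/
private theorem step_add_step_swap {n : ℕ} {μ : Nat.Partition n}
    (T : StdFilling n μ.youngDiagram) (k : Fin n) :
    tableauDegreeStep 2 T.1 k + tableauDegreeStep 2 (Prod.swap ∘ T.1) k =
      (((addableNodes (prefixCells T.1 k)).filter fun B =>
          cellResidue 2 B = cellResidue 2 (T.1 k)).card : ℤ) -
        (((removableNodes (prefixCells T.1 k)).filter fun B =>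
          cellResidue 2 B = cellResidue 2 (T.1 k)).card : ℤ) + 1 := by
  have hP := isLowerSet_prefixCells T k
  have hA := isRemovableNode_prefixCells T k
  have ha := card_filter_add_of_subset_addableNodes hP hA
    (S := (addableNodes (prefixCells T.1 k)).filter fun B =>
      cellResidue 2 B = cellResidue 2 (T.1 k))
    (Finset.filter_subset _ _)
  have hr := card_filter_add_of_subset_removableNodes hP hA
    (S := (removableNodes (prefixCells T.1 k)).filter fun B =>
      cellResidue 2 B = cellResidue 2 (T.1 k))
    (Finset.filter_subset _ _) (Finset.mem_filter.2 ⟨mem_removableNodes.2 hA, rfl⟩)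
  simp only [Finset.filter_filter] at ha hr
  rw [tableauDegreeStep_swap]
  unfold tableauDegreeStep
  omega

/-- Growing the prefix of a standard filling by the entry `k` adds the new cell `T.1 k`; and
`prefixCells T.1 k` is the prefix of the entries `< k + 1`. [folklore] -/
private theorem image_filter_lt_succ {n : ℕ} {Y : YoungDiagram} (T : StdFilling n Y) (k : Fin n) :
    (Finset.univ.filter fun j : Fin n => (j : ℕ) < (k : ℕ) + 1).image T.1 =
        insert (T.1 k) ((Finset.univ.filter fun j : Fin n => (j : ℕ) < (k : ℕ)).image T.1) ∧
      T.1 k ∉ (Finset.univ.filter fun j : Fin n => (j : ℕ) < (k : ℕ)).image T.1 ∧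
      prefixCells T.1 k =
        (Finset.univ.filter fun j : Fin n => (j : ℕ) < (k : ℕ) + 1).image T.1 := by
  refine ⟨?_, ?_, ?_⟩
  · rw [← Finset.image_insert]
    congr 1
    ext j
    simp only [Finset.mem_filter, Finset.mem_univ, true_and, Finset.mem_insert, Fin.ext_iff]
    omega
  · rw [Finset.mem_image]
    rintro ⟨j, hj, hjk⟩
    rw [Finset.mem_filter, T.injective hjk] at hj
    exact lt_irrefl _ hj.2
  · unfold prefixCells
    congr 1
    ext j
    simp only [Finset.mem_filter, Finset.mem_univ, true_and, Fin.le_def, Nat.lt_add_one_iff]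

/-- A standard Young tableau of shape `μ ⊢ n` fills every cell. [folklore] -/
private theorem image_filter_lt_self {n : ℕ} {μ : Nat.Partition n}
    (T : StdFilling n μ.youngDiagram) :
    (Finset.univ.filter fun j : Fin n => (j : ℕ) < n).image T.1 = μ.youngDiagram.cells := by
  rw [Finset.filter_true_of_mem fun j _ => j.2]
  ext x
  simp only [Finset.mem_image, Finset.mem_univ, true_and, YoungDiagram.mem_cells]
  exact ⟨fun ⟨j, hj⟩ => hj ▸ T.mem j, fun hx => T.exists_eq μ.card_cells_youngDiagram hx⟩

/-- **The per-step identity in telescoping form.** With `Q m` the cells of the entries `< m` and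
`W(S) = c₀(S) − (c₀(S) − c₁(S))²` (`cᵢ(S)` = number of cells of `S` of `2`-residue `i`, here
`G m = W(Q m)`): `step_k(T) + step_k(Tᵗ) = W(Q (k+1)) − W(Q k)`, since `Q (k+1) = Q k ∪ {A}` and
`a_i − r_i + 1` is `2 − 2ξ` for `i = 0` and `2ξ + 1` for `i = 1` (`ξ` of `Q (k+1)`). [folklore] -/
private theorem step_eq_weight_sub {n : ℕ} {μ : Nat.Partition n}
    (T : StdFilling n μ.youngDiagram) (k : Fin n) (G : ℕ → ℤ)
    (hG : ∀ m : ℕ, G m =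
      ((((Finset.univ.filter fun j : Fin n => (j : ℕ) < m).image T.1).filter
          fun x => cellResidue 2 x = 0).card : ℤ) -
        (((((Finset.univ.filter fun j : Fin n => (j : ℕ) < m).image T.1).filter
            fun x => cellResidue 2 x = 0).card : ℤ) -
          ((((Finset.univ.filter fun j : Fin n => (j : ℕ) < m).image T.1).filter
            fun x => ¬cellResidue 2 x = 0).card : ℤ)) ^ 2) :
    tableauDegreeStep 2 T.1 k + tableauDegreeStep 2 (Prod.swap ∘ T.1) k =
      G ((k : ℕ) + 1) - G (k : ℕ) := by
  have hP := isLowerSet_prefixCells T k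
  have hA := isRemovableNode_prefixCells T k
  obtain ⟨h0, h1⟩ := sl2_weight hP hA
  obtain ⟨hins, hnot, hpre⟩ := image_filter_lt_succ T k
  rw [step_add_step_swap T k, hG, hG, hpre, hins]
  rw [hpre, hins] at h0 h1
  have hnot0 : T.1 k ∉ ((Finset.univ.filter fun j : Fin n => (j : ℕ) < (k : ℕ)).image T.1).filter
      fun x => cellResidue 2 x = 0 := fun h => hnot (Finset.mem_filter.1 h).1
  have hnot1 : T.1 k ∉ ((Finset.univ.filter fun j : Fin n => (j : ℕ) < (k : ℕ)).image T.1).filter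
      fun x => ¬cellResidue 2 x = 0 := fun h => hnot (Finset.mem_filter.1 h).1
  have h10 : ¬(1 : ZMod 2) = 0 := by decide
  rcases zmod_two_cases (cellResidue 2 (T.1 k)) with hres | hres
  · simp only [hres, Finset.filter_insert, if_true, not_true_eq_false, if_false,
      Finset.card_insert_of_notMem hnot0] at h0 h1 ⊢
    push_cast at h0 h1 ⊢
    linear_combination h0
  · simp only [hres, h10, Finset.filter_insert, if_true, not_false_eq_true, if_false,
      Finset.card_insert_of_notMem hnot1, zmod_two_eq_one_iff] at h0 h1 ⊢
    push_cast at h0 h1 ⊢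
    linear_combination h1

set_option linter.dupNamespace false in -- deliberate Summit.<S>.<P> duplicate
/-- **Stub `stub_transposeDegree` (line `klr-graded-polynomial-method`, crux
`SnSubsetDichotomy.NoThresholdSubsetTriple`, stmt-MatrixMultiplication-8302): transpose symmetry
of the Brundan–Kleshchev–Wang `2`-degree.** For every standard Young tableau `T` of shape
`μ ⊢ n`, the `2`-degrees of `T` and of its transpose `Tᵗ` (growth sequence `Prod.swap ∘ T.1`)
add up to the weight of the `2`-block of `μ`: `deg₂ T + deg₂ Tᵗ = c₀ − (c₀ − c₁)²`,
`cᵢ = residueContent 2 μ i` the number of cells of `2`-residue `i` (Brundan–Kleshchev–Wang's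
`deg + codeg = defect` at `e = 2`). Per step `k` (new cell `A` of residue `i` in the prefix
`P`): `step_k(T) + step_k(Tᵗ) = a_i(P) − r_i(P) + 1` by the corner dichotomy and the
`swap`-invariance of `2`-residues, `= W(P) − W(P ∖ A)` by the `sl₂`-weight identities
`a₀ − r₀ = 1 − 2ξ`, `a₁ − r₁ = 2ξ`; the sum over `k` telescopes. [folklore] -/
theorem stub_transposeDegree : ∀ (n : ℕ) (μ : Nat.Partition n) (T : StdFilling n μ.youngDiagram), tableauDegree 2 T.1 + tableauDegree 2 (Prod.swap ∘ T.1) = (residueContent 2 μ 0 : ℤ) - ((residueContent 2 μ 0 : ℤ) - (residueContent 2 μ 1 : ℤ)) ^ 2 := by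
  intro n μ T
  set G : ℕ → ℤ := fun m =>
    ((((Finset.univ.filter fun j : Fin n => (j : ℕ) < m).image T.1).filter
        fun x => cellResidue 2 x = 0).card : ℤ) -
      (((((Finset.univ.filter fun j : Fin n => (j : ℕ) < m).image T.1).filter
          fun x => cellResidue 2 x = 0).card : ℤ) -
        ((((Finset.univ.filter fun j : Fin n => (j : ℕ) < m).image T.1).filter
          fun x => ¬cellResidue 2 x = 0).card : ℤ)) ^ 2 with hG
  have hstep : ∀ k : Fin n,
      tableauDegreeStep 2 T.1 k + tableauDegreeStep 2 (Prod.swap ∘ T.1) k =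
        G ((k : ℕ) + 1) - G (k : ℕ) :=
    fun k => step_eq_weight_sub T k G fun m => by rw [hG]
  have htel : ∑ k : Fin n, (G ((k : ℕ) + 1) - G (k : ℕ)) = G n - G 0 :=
    (Fin.sum_univ_eq_sum_range (fun m => G (m + 1) - G m) n).trans (Finset.sum_range_sub G n)
  have e1 : (μ.youngDiagram.cells.filter fun c => cellResidue 2 c = 1) =
      μ.youngDiagram.cells.filter fun c => ¬cellResidue 2 c = 0 :=
    Finset.filter_congr fun c _ => zmod_two_eq_one_iff _
  have e0 : (Finset.univ.filter fun j : Fin n => (j : ℕ) < 0).image T.1 = ∅ := by simp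
  unfold tableauDegree residueContent
  rw [← Finset.sum_add_distrib, Finset.sum_congr rfl fun k _ => hstep k, htel, e1]
  simp only [hG, image_filter_lt_self T, e0, Finset.filter_empty, Finset.card_empty]
  push_cast
  ring

end Summit.MatrixMultiplication.MatrixMultiplication.Theorems
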